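import Mathlib.Algebra.Order.Field.GeomSum
import Mathlib.Analysis.SpecificLimits.Basic
import Mathlib.Topology.EMetricSpace.Lipschitz
import Mathlib.Analysis.Normed.Group.Uniform
import Mathlib.Order.Filter.AtTopBot.Archimedean
import HarnessLib

/-!
# Transit-time schedules of itineraries under a Lipschitz roof function

Topic `Literature/Dynamics/Hyperbolic`.  Elementary, fully proved bookkeeping (no definitions, no named
facts) for the time schedules `T₀ < T₁ < ⋯`, `Tₙ₊₁ = Tₙ + ρ(xₙ)`, generated by an itinerary `(xₙ)` of
a section / return map under a transit-time ("roof") function `ρ` — the suspension-flow side of every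
shadowing-to-periodic-orbit argument (Bowen's closing of pseudo-orbits of flows, Pilyugin 1999 §1.5;
here used by the Navier–Stokes line `homoclinic-excursion-trains` of `Summits/AnomalousDissipation`):

* `abs_sum_sub_sum_le_of_lipschitzOnWith` — **schedule drift**: two itineraries in the set where `ρ`
  is `L`-Lipschitz have partial schedules differing by at most `L · Σ ‖xⱼ − yⱼ‖`;
* `eq_add_sum_of_succ_eq_add`, `sub_eq_sum_of_succ_eq_add` — a `ℤ`-indexed schedule with
  `g(n+1) = g(n) + h(n)` has `g(n+k) = g(n) + Σ_{j<k} h(n+j)` and `g(n) − g(n−k) = Σ_{j<k} h(n−1−j)`;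
* `exists_mem_Ioc_of_strictMono_int` — a strictly increasing `ℤ`-indexed schedule exhausting `ℝ` in
  both directions locates every time in a unique slot `(g n, g (n+1)]`;
* `tendsto_atTop_of_add_period` — a monotone `ℕ`-schedule with `T(n+M) = T(n) + P`, `P > 0`, tends
  to `+∞`;
* `exists_mem_Ioc_of_mem_Ioc_of_strictMono` — a time in `(T a, T b]` lies in a slot `(T k, T (k+1)]`,
  `a ≤ k < b`;
* `abs_sum_sub_mul_le_of_norm_sub_le_geometric`, `abs_sum_sub_sum_le_of_norm_sub_le_two_sided`,
  `abs_sum_sub_mul_le_of_norm_sub_le_two_sided` — the drift bounds combined with the geometric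
  deviation bounds of a tail / a tracked segment / a tracked dwell;
* `sum_pow_add_pow_sub_le`, `sum_pow_add_pow_sub_one_sub_le`, `sum_pow_add_le` — the two-sided
  geometric sums `Σ_{i≤n} (θⁱ + θⁿ⁻ⁱ) ≤ 2/(1−θ)`, `Σ_{i<m} (θⁱ + θ^{m−1−i}) ≤ 2/(1−θ)`,
  `Σ_{i<m} θ^{N+i} ≤ θᴺ/(1−θ)` that bound the accumulated deviation of an orbit TRACKING a
  hyperbolic reference orbit with two-sided rate `θ` (cf. `HyperbolicTracking.TracksWith`).

Mathlib: `LipschitzOnWith.dist_le_mul`, `Finset.abs_sum_le_sum_abs`, `Finset.sum_range_succ`,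
`Finset.sum_range_reflect`, `geom_sum_Ico_le_of_lt_one`, `Int.exists_greatest_of_bdd`.

## References

* S. Yu. Pilyugin, *Shadowing in Dynamical Systems*, LNM 1706, Springer (1999), §1.5 (shadowing for
  flows: reparametrisation along return times). [Pilyugin1999]
-/

noncomputable section

open Set Filter Finset
open scoped Topology NNReal

namespace Literature.Dynamics.Hyperbolic

/-! ## Schedule drift under a Lipschitz roof function -/

/-- **Schedule drift.** If the roof function `ρ` is `L`-Lipschitz on `S` and two itineraries
`a, b : ℕ → X` stay in `S` for `j < k`, then their partial schedules differ by at most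
`L Σ_{j<k} ‖aⱼ − bⱼ‖`. [folklore] -/
theorem abs_sum_sub_sum_le_of_lipschitzOnWith {X : Type*} [NormedAddCommGroup X] {ρ : X → ℝ}
    {L : ℝ≥0} {S : Set X} (hρ : LipschitzOnWith L ρ S) {a b : ℕ → X} {k : ℕ}
    (ha : ∀ j < k, a j ∈ S) (hb : ∀ j < k, b j ∈ S) :
    |∑ j ∈ range k, ρ (a j) - ∑ j ∈ range k, ρ (b j)| ≤ L * ∑ j ∈ range k, ‖a j - b j‖ := by
  rw [← sum_sub_distrib, mul_sum]
  refine (abs_sum_le_sum_abs _ _).trans (sum_le_sum fun j hj => ?_)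
  have h := hρ.dist_le_mul _ (ha j (mem_range.1 hj)) _ (hb j (mem_range.1 hj))
  rwa [Real.dist_eq, dist_eq_norm] at h

/-! ## `ℤ`-indexed schedules generated by a step function -/

/-- `g(n + k) = g(n) + Σ_{j<k} h(n + j)` when `g(n+1) = g(n) + h(n)`. [folklore] -/
theorem eq_add_sum_of_succ_eq_add {g h : ℤ → ℝ} (hs : ∀ n, g (n + 1) = g n + h n) (n : ℤ) (k : ℕ) :
    g (n + k) = g n + ∑ j ∈ range k, h (n + j) := by
  induction k with
  | zero => simp
  | succ k ih =>
    rw [sum_range_succ, ← add_assoc, ← ih, Nat.cast_succ, ← add_assoc, hs]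

/-- `g(n) − g(n − k) = Σ_{j<k} h(n − 1 − j)` when `g(n+1) = g(n) + h(n)` (backward reading of a
schedule, most recent step first). [folklore] -/
theorem sub_eq_sum_of_succ_eq_add {g h : ℤ → ℝ} (hs : ∀ n, g (n + 1) = g n + h n) (n : ℤ) (k : ℕ) :
    g n - g (n - k) = ∑ j ∈ range k, h (n - 1 - j) := by
  induction k with
  | zero => simp
  | succ k ih =>
    rw [sum_range_succ, ← ih]
    have h1 := hs (n - (k + 1 : ℕ))
    rw [show n - ((k + 1 : ℕ) : ℤ) + 1 = n - k by push_cast; ring] at h1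
    rw [h1, show n - 1 - (k : ℤ) = n - ((k + 1 : ℕ) : ℤ) by push_cast; ring]
    ring

/-- **Locating a time in a `ℤ`-indexed schedule.** A strictly increasing `g : ℤ → ℝ` with
`g → ±∞` at `±∞` puts every real `t` in a slot `(g n, g (n + 1)]`. [folklore] -/
theorem exists_mem_Ioc_of_strictMono_int {g : ℤ → ℝ} (hg : StrictMono g)
    (htop : Tendsto g atTop atTop) (hbot : Tendsto g atBot atBot) (t : ℝ) :
    ∃ n : ℤ, t ∈ Ioc (g n) (g (n + 1)) := by
  obtain ⟨N, hN⟩ := (htop.eventually (eventually_ge_atTop t)).exists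
  obtain ⟨m, hm⟩ := (hbot.eventually (eventually_lt_atBot t)).exists
  obtain ⟨n, hn, hmax⟩ := Int.exists_greatest_of_bdd (P := fun n => g n < t)
    ⟨N, fun z hz => le_of_lt (hg.lt_iff_lt.1 (hz.trans_le hN))⟩ ⟨m, hm⟩
  exact ⟨n, hn, not_lt.1 fun h => by have := hmax (n + 1) h; omega⟩

/-- The slots of a strictly increasing `ℤ`-schedule are disjoint. [folklore] -/
theorem eq_of_mem_Ioc_of_strictMono_int {g : ℤ → ℝ} (hg : StrictMono g) {t : ℝ} {n m : ℤ}
    (hn : t ∈ Ioc (g n) (g (n + 1))) (hm : t ∈ Ioc (g m) (g (m + 1))) : n = m := by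
  by_contra hne
  rcases lt_or_gt_of_ne hne with h | h
  · exact absurd (hn.2.trans (hg.monotone (by omega))) (not_le.2 hm.1)
  · exact absurd (hm.2.trans (hg.monotone (by omega))) (not_le.2 hn.1)

/-! ## Periodic `ℕ`-schedules -/

/-- A monotone schedule that gains `P > 0` every `M` slots tends to `+∞`. [folklore] -/
theorem tendsto_atTop_of_add_period {T : ℕ → ℝ} (hT : Monotone T) {M : ℕ} {P : ℝ}
    (hP : 0 < P) (hTM : ∀ n, T (n + M) = T n + P) : Tendsto T atTop atTop := by
  have hk : ∀ k : ℕ, T (k * M) = T 0 + k * P := fun k => by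
    induction k with
    | zero => simp
    | succ k ih => rw [Nat.succ_mul, hTM, ih, Nat.cast_succ]; ring
  refine tendsto_atTop_atTop.2 fun b => ?_
  obtain ⟨k, hk'⟩ := exists_nat_ge ((b - T 0) / P)
  refine ⟨k * M, fun n hn => ?_⟩
  have h1 : b ≤ T 0 + k * P := by
    rw [div_le_iff₀ hP] at hk'
    linarith
  exact h1.trans ((hk k).symm.le.trans (hT hn))

/-! ## Two-sided geometric sums -/

/-- `Σ_{i<m} θⁱ ≤ 1/(1 − θ)` for `0 ≤ θ < 1`. [folklore] -/
theorem sum_pow_le_one_div {θ : ℝ} (hθ : 0 ≤ θ) (hθ1 : θ < 1) (m : ℕ) :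
    ∑ i ∈ range m, θ ^ i ≤ 1 / (1 - θ) := by
  have h := geom_sum_Ico_le_of_lt_one (m := 0) (n := m) hθ hθ1
  rwa [pow_zero, ← range_eq_Ico] at h

/-- `Σ_{i<m} θ^{N+i} ≤ θᴺ/(1 − θ)` for `0 ≤ θ < 1` (tail of the geometric series). [folklore] -/
theorem sum_pow_add_le {θ : ℝ} (hθ : 0 ≤ θ) (hθ1 : θ < 1) (N m : ℕ) :
    ∑ i ∈ range m, θ ^ (N + i) ≤ θ ^ N / (1 - θ) := by
  have h : ∑ i ∈ range m, θ ^ (N + i) = θ ^ N * ∑ i ∈ range m, θ ^ i := by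
    rw [mul_sum]; exact sum_congr rfl fun i _ => pow_add θ N i
  rw [h, ← mul_one_div]
  exact mul_le_mul_of_nonneg_left (sum_pow_le_one_div hθ hθ1 m) (pow_nonneg hθ N)

/-- **Two-sided tracking sum along a segment**: `Σ_{i ≤ n} (θⁱ + θⁿ⁻ⁱ) ≤ 2/(1 − θ)`. [folklore] -/
theorem sum_pow_add_pow_sub_le {θ : ℝ} (hθ : 0 ≤ θ) (hθ1 : θ < 1) (n : ℕ) :
    ∑ i ∈ range (n + 1), (θ ^ i + θ ^ (n - i)) ≤ 2 / (1 - θ) := by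
  rw [sum_add_distrib]
  have h1 := sum_pow_le_one_div hθ hθ1 (n + 1)
  have h2 : ∑ i ∈ range (n + 1), θ ^ (n - i) = ∑ i ∈ range (n + 1), θ ^ i := by
    rw [← sum_range_reflect (fun i => θ ^ i) (n + 1)]
    exact sum_congr rfl fun i _ => by simp
  rw [h2, show (2 : ℝ) / (1 - θ) = 1 / (1 - θ) + 1 / (1 - θ) by ring]
  linarith

/-- **Two-sided tracking sum along a dwell**: `Σ_{i < m} (θⁱ + θ^{m−1−i}) ≤ 2/(1 − θ)`. [folklore] -/
theorem sum_pow_add_pow_sub_one_sub_le {θ : ℝ} (hθ : 0 ≤ θ) (hθ1 : θ < 1) (m : ℕ) :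
    ∑ i ∈ range m, (θ ^ i + θ ^ (m - 1 - i)) ≤ 2 / (1 - θ) := by
  rw [sum_add_distrib]
  have h1 := sum_pow_le_one_div hθ hθ1 m
  have h2 : ∑ i ∈ range m, θ ^ (m - 1 - i) = ∑ i ∈ range m, θ ^ i :=
    sum_range_reflect (fun i => θ ^ i) m
  rw [h2, show (2 : ℝ) / (1 - θ) = 1 / (1 - θ) + 1 / (1 - θ) by ring]
  linarith

/-- A geometric tail is eventually below any positive threshold: `a · θ^{N − n₀} ≤ b` for all large
`N` (`0 ≤ θ < 1`, `0 < b`). [folklore] -/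
theorem eventually_mul_pow_sub_le {θ : ℝ} (hθ : 0 ≤ θ) (hθ1 : θ < 1) (a : ℝ) {b : ℝ} (hb : 0 < b)
    (n₀ : ℕ) : ∀ᶠ N : ℕ in atTop, a * θ ^ (N - n₀) ≤ b := by
  have h : Tendsto (fun N : ℕ => a * θ ^ (N - n₀)) atTop (𝓝 (a * 0)) :=
    ((tendsto_pow_atTop_nhds_zero_of_lt_one hθ hθ1).comp (tendsto_sub_atTop_nat n₀)).const_mul a
  rw [mul_zero] at h
  exact h.eventually_le_const hb

/-! ## Locating a time inside a finite stretch of a schedule -/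

/-- In a strictly increasing schedule, a time `t ∈ (T a, T b]` lies in a slot `(T k, T (k+1)]` with
`a ≤ k < b` (no unboundedness needed). [folklore] -/
theorem exists_mem_Ioc_of_mem_Ioc_of_strictMono {T : ℕ → ℝ} (hT : StrictMono T) {t : ℝ} {a b : ℕ}
    (ht : t ∈ Ioc (T a) (T b)) : ∃ k, a ≤ k ∧ k < b ∧ t ∈ Ioc (T k) (T (k + 1)) := by
  classical
  have hex : ∃ k, t ≤ T (k + 1) := by
    rcases b with _ | b
    · exact absurd (ht.1.trans_le (ht.2.trans (hT.monotone (Nat.zero_le a)))) (lt_irrefl _)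
    · exact ⟨b, ht.2⟩
  set k := Nat.find hex with hk
  have hk1 : t ≤ T (k + 1) := Nat.find_spec hex
  have hk2 : T k < t := by
    rcases h : k with _ | k'
    · exact lt_of_le_of_lt (hT.monotone (Nat.zero_le a)) ht.1
    · exact lt_of_not_ge (Nat.find_min hex (m := k') (by omega))
  refine ⟨k, ?_, ?_, hk2, hk1⟩
  · by_contra hlt
    exact absurd (hk1.trans (hT.monotone (by omega))) (not_le.2 ht.1)
  · by_contra hge
    exact absurd ((hT.monotone (not_lt.1 hge)).trans_lt hk2) (not_lt.2 ht.2)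

/-! ## Schedule drift under geometric deviation bounds -/

section GeometricDrift

variable {X : Type*} [NormedAddCommGroup X] {ρ : X → ℝ} {L : ℝ≥0} {S : Set X}

/-- **Drift along a tail converging geometrically to a fixed point.** If the itinerary `a` stays
in `S` with `‖aⱼ − p‖ ≤ c θ^{N+j}`, then `|Σ_{j<n} ρ(aⱼ) − n ρ(p)| ≤ L c θᴺ/(1 − θ)`. [folklore] -/
theorem abs_sum_sub_mul_le_of_norm_sub_le_geometric (hρ : LipschitzOnWith L ρ S) {a : ℕ → X}
    {p : X} (ha : ∀ j, a j ∈ S) (hp : p ∈ S) {c θ : ℝ} (hc : 0 ≤ c) (hθ : 0 ≤ θ) (hθ1 : θ < 1)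
    {N : ℕ} (hdev : ∀ j, ‖a j - p‖ ≤ c * θ ^ (N + j)) (n : ℕ) :
    |∑ j ∈ range n, ρ (a j) - n * ρ p| ≤ L * (c * (θ ^ N / (1 - θ))) := by
  rw [show (n : ℝ) * ρ p = ∑ j ∈ range n, ρ p by simp]
  refine (abs_sum_sub_sum_le_of_lipschitzOnWith hρ (fun j _ => ha j) (fun _ _ => hp)).trans ?_
  refine mul_le_mul_of_nonneg_left ?_ L.2
  calc ∑ j ∈ range n, ‖a j - p‖ ≤ ∑ j ∈ range n, c * θ ^ (N + j) := sum_le_sum fun j _ => hdev j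
    _ ≤ c * (θ ^ N / (1 - θ)) := by
        rw [← mul_sum]; exact mul_le_mul_of_nonneg_left (sum_pow_add_le hθ hθ1 _ _) hc

/-- **Drift along a segment tracked with two-sided rate `θ`.** If `‖aⱼ − bⱼ‖ ≤ c(θʲ + θⁿ⁻ʲ)` for
`j ≤ n`, then every partial schedule difference `|Σ_{j<k} ρ(aⱼ) − Σ_{j<k} ρ(bⱼ)|`, `k ≤ n + 1`,
is at most `L c · 2/(1 − θ)`. [folklore] -/
theorem abs_sum_sub_sum_le_of_norm_sub_le_two_sided (hρ : LipschitzOnWith L ρ S) {a b : ℕ → X}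
    (ha : ∀ j, a j ∈ S) (hb : ∀ j, b j ∈ S) {c θ : ℝ} (hc : 0 ≤ c) (hθ : 0 ≤ θ) (hθ1 : θ < 1)
    {n : ℕ} (hdev : ∀ j ≤ n, ‖a j - b j‖ ≤ c * (θ ^ j + θ ^ (n - j))) {k : ℕ} (hk : k ≤ n + 1) :
    |∑ j ∈ range k, ρ (a j) - ∑ j ∈ range k, ρ (b j)| ≤ L * (c * (2 / (1 - θ))) := by
  refine (abs_sum_sub_sum_le_of_lipschitzOnWith hρ (fun j _ => ha j) (fun j _ => hb j)).trans ?_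
  refine mul_le_mul_of_nonneg_left ?_ L.2
  calc ∑ j ∈ range k, ‖a j - b j‖ ≤ ∑ j ∈ range (n + 1), ‖a j - b j‖ :=
        sum_le_sum_of_subset_of_nonneg (range_mono hk) fun _ _ _ => norm_nonneg _
    _ ≤ ∑ j ∈ range (n + 1), c * (θ ^ j + θ ^ (n - j)) :=
        sum_le_sum fun j hj => hdev j (by have := mem_range.1 hj; omega)
    _ ≤ c * (2 / (1 - θ)) := by
        rw [← mul_sum]; exact mul_le_mul_of_nonneg_left (sum_pow_add_pow_sub_le hθ hθ1 _) hc

/-- **Drift along a dwell tracked with two-sided rate `θ` against a fixed point.** If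
`‖aⱼ − p‖ ≤ c(θʲ + θ^{m−1−j})` for `j < m`, then `|Σ_{j<k} ρ(aⱼ) − k ρ(p)| ≤ L c · 2/(1 − θ)` for
every `k ≤ m`. [folklore] -/
theorem abs_sum_sub_mul_le_of_norm_sub_le_two_sided (hρ : LipschitzOnWith L ρ S) {a : ℕ → X}
    {p : X} (ha : ∀ j, a j ∈ S) (hp : p ∈ S) {c θ : ℝ} (hc : 0 ≤ c) (hθ : 0 ≤ θ) (hθ1 : θ < 1)
    {m : ℕ} (hdev : ∀ j < m, ‖a j - p‖ ≤ c * (θ ^ j + θ ^ (m - 1 - j))) {k : ℕ} (hk : k ≤ m) :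
    |∑ j ∈ range k, ρ (a j) - k * ρ p| ≤ L * (c * (2 / (1 - θ))) := by
  rw [show (k : ℝ) * ρ p = ∑ j ∈ range k, ρ p by simp]
  refine (abs_sum_sub_sum_le_of_lipschitzOnWith hρ (fun j _ => ha j) (fun _ _ => hp)).trans ?_
  refine mul_le_mul_of_nonneg_left ?_ L.2
  calc ∑ j ∈ range k, ‖a j - p‖ ≤ ∑ j ∈ range m, ‖a j - p‖ :=
        sum_le_sum_of_subset_of_nonneg (range_mono hk) fun _ _ _ => norm_nonneg _
    _ ≤ ∑ j ∈ range m, c * (θ ^ j + θ ^ (m - 1 - j)) :=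
        sum_le_sum fun j hj => hdev j (mem_range.1 hj)
    _ ≤ c * (2 / (1 - θ)) := by
        rw [← mul_sum]; exact mul_le_mul_of_nonneg_left (sum_pow_add_pow_sub_one_sub_le hθ hθ1 _) hc

end GeometricDrift

end Literature.Dynamics.Hyperbolic
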